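import Mathlib
import Summits.ResolutionOfSingularities.ResolutionOfSingularities.Theorems.WeightedInvariantLocalWeightedDropTOT2Near

/-!
# `WeightedInvariant.LocalWeightedDrop`, TOT₂ line (skeleton v32, residual `stub_spaceNCRankDrop`), piece S-NEAR part 3:
# (N3) NEAR POINTS OF A PERMISSIBLE BLOW-UP WITH A COORDINATE CENTRE LIE ON `ℙ(Dir / T_C)` (hypersurface form, every characteristic,
# every dimension)

Crux item stmt-ResolutionOfSingularities-8899 `LocalWeightedDrop`; sub-line TOT2-LINE v1/v1.1 (`L/res-L1-w43-lead-1/g4/TOT2-LINE.md`) §4 (N3).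
[OURS · L1 W4.3, chain w43, res-L1-w43-stub-3 (gen 4) = S-NEAR hand (plan-1 DEALS gen 10 #9).  MODEL: Cossart–Jannsen–Saito, LNM 2270 (2020)
Thm 2.6 (2)/(3) and Thm 2.14 (near points of the blow-up in a permissible centre `D ∋ x` lie on `ℙ(Dir_x(X)/T_x(D))`; corpus p0034, p0038) for a
HYPERSURFACE germ and a centre that is a COORDINATE SUBSPACE `C = V(x_l : w_l = 1)` in the move's coordinates — the S-SET convention
(`IsBPermissible`: weights `w ∈ {0,1}^{n+1}`, (P1) `f ∈ 𝔭_C^{o}` as `o ≤ weightedOrder_w f`).  Nothing here is a statement of H. Hironaka's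
manuscript; AI-written, gate-accepted means sorry-free with standard axioms, not refereed.  Def-free; the point case `w ≡ 1` is part 1.]

SETTING.  `f ∈ k⟦x_0..x_n⟧`, weights `w` with `w_l ≤ 1`, exceptional point `c` with the chart convention `w_l = 0 → c_l = 0` (a point of the
exceptional divisor OVER THE ORIGIN `x`), live slot `i₀` with `c_{i₀} ≠ 0`, chart `x_l ↦ s^{w_l}(c_l + y_l)` (`CobordantChart.chart w c`),
PERMISSIBILITY `hperm : o ≤ weightedOrder_w f` (`f ∈ 𝔭_C^o`; with `w ≤ 1` this forces `o ≤ ord f`, and the content is at `o = ord f`),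
factorisation `hfac : f ∘ chart = s^o · G`, successor `G′ = G|_{y_{i₀} = 0}` (`TupleGame.slice i₀ G`), NEAR = `o ≤ ord G′`;
`in_o f := v ↦ CobordantChart.initEval 1 v o f`, invariance vectors `u` : `∀ v, in_o f (v + u) = in_o f (v)` (written out; `Dir`).
* `apply_eq_zero_of_perm` — PERMISSIBILITY READS ON THE INITIAL FORM: `in_o f ∈ k[x_l : w_l = 1]`.
* `initEval_add_eq_of_perm` — `T_x C ⊆ Dir`: every vector supported on the weight-`0` letters is an invariance vector of `in_o f`.
* `coeff_cons_slice_subst_chart_w`, `taylorSum_eq_coeff_slice_w`, `taylorSum_eq_zero_of_near_curve` — the Taylor coefficients of `in_o f` at `c`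
  off `x_{i₀}` are `s^o`-coefficients of the sliced total transform (general weights), hence vanish below degree `o` at a near point.
* **`initEval_add_smul_eq_of_near_curve`** — (N3): NEAR ⇒ `c ∈ Dir(in_o f)` (so the near points over `x`, read in `ℙ(N_x) = ℙ(k^{I})`,
  lie on `ℙ(Dir / T_x C)`).
* **`order_slice_lt_of_apexLine_curve`** — `e_x ≤ 1` and the centre is not the point (`w_l = 0` for some `l`) ⇒ NO near point over `x`.
* **`near_dependent_of_apexPlane_curve`** — `e_x ≤ 2` ⇒ any two near points over `x` are proportional (AT MOST ONE near point of a curve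
  blow-up in three-space over the point).
-/

set_option linter.dupNamespace false -- mandated namespace of this single-conjunct summit
set_option autoImplicit false

namespace Summit.ResolutionOfSingularities.ResolutionOfSingularities.Theorems

namespace TOT2Near

open MvPowerSeries Literature.AlgebraicGeometry.Resolution

variable {k : Type} [Field k] {n : ℕ}

/-! ## §1 Weights in `{0,1}`: exponent bookkeeping and what permissibility says about the initial form -/

/-- For weights `w_l ≤ 1`: an exponent whose `w`-weight equals its degree vanishes on the weight-`0` letters. -/
theorem apply_eq_zero_of_weight_eq_degree {w : Fin n → ℕ} (hw : ∀ l, w l ≤ 1) {d : Fin n →₀ ℕ}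
    (h : Finsupp.weight w d = d.degree) {l : Fin n} (hl : w l = 0) : d l = 0 := by
  classical
  have hsplit := NCTransport.degree_eq_weight_add_sum_filter hw d
  have hsum : ∑ l ∈ Finset.univ.filter (fun l => w l = 0), d l = 0 := by omega
  exact Finset.sum_eq_zero_iff.mp hsum l (Finset.mem_filter.mpr ⟨Finset.mem_univ l, hl⟩)

/-- For weights `w_l ≤ 1`: an exponent vanishing on the weight-`0` letters has `w`-weight equal to its degree. -/
theorem weight_eq_degree_of_apply_eq_zero {w : Fin n → ℕ} (hw : ∀ l, w l ≤ 1) {d : Fin n →₀ ℕ}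
    (h : ∀ l, w l = 0 → d l = 0) : Finsupp.weight w d = d.degree := by
  classical
  rw [NCTransport.degree_eq_weight_add_sum_filter hw d,
    Finset.sum_eq_zero (fun l hl => h l (Finset.mem_filter.mp hl).2), add_zero]

/-- **PERMISSIBILITY READS ON THE INITIAL FORM**: if `f ∈ 𝔭_C^o` (`o ≤ weightedOrder_w f`, `w ≤ 1` the indicator of the centre letters),
every degree-`o` exponent in the support of `f` vanishes on the weight-`0` letters — `in_o f ∈ k[x_l : w_l = 1]`. -/
theorem apply_eq_zero_of_perm {w : Fin n → ℕ} (hw : ∀ l, w l ≤ 1) {f : MvPowerSeries (Fin n) k} {o : ℕ}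
    (hperm : (o : ℕ∞) ≤ f.weightedOrder w) {d : Fin n →₀ ℕ} (hd : d.degree = o) (hdf : coeff d f ≠ 0) {l : Fin n}
    (hl : w l = 0) : d l = 0 := by
  refine apply_eq_zero_of_weight_eq_degree hw (le_antisymm (NCTransport.weight_le_degree_of_le_one hw d) ?_) hl
  rw [hd]
  by_contra hlt
  rw [not_le] at hlt
  exact hdf (MvPowerSeries.coeff_eq_zero_of_lt_weightedOrder w (lt_of_lt_of_le (by exact_mod_cast hlt) hperm))

/-- **`T_x C ⊆ Dir`**: under permissibility every vector supported on the weight-`0` letters (a tangent vector of the centre) is a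
translation-invariance vector of the degree-`o` form of `f`. -/
theorem initEval_add_eq_of_perm {w : Fin n → ℕ} (hw : ∀ l, w l ≤ 1) {f : MvPowerSeries (Fin n) k} {o : ℕ}
    (hperm : (o : ℕ∞) ≤ f.weightedOrder w) {u : Fin n → k} (hu : ∀ l, w l ≠ 0 → u l = 0) (v : Fin n → k) :
    CobordantChart.initEval (fun _ : Fin n => 1) (v + u) o f = CobordantChart.initEval (fun _ : Fin n => 1) v o f := by
  rw [ApexFreeOrderDrop.initEval_one_eq_sum, ApexFreeOrderDrop.initEval_one_eq_sum]
  refine Finset.sum_congr rfl fun e he => ?_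
  rw [ApexFreeOrderDrop.mem_antidiag_iff, ApexFreeOrderDrop.weight_one_eq_degree] at he
  by_cases hef : coeff e f = 0
  · rw [hef, zero_mul, zero_mul]
  · congr 1
    refine Finset.prod_congr rfl fun l _ => ?_
    by_cases hl : w l = 0
    · rw [apply_eq_zero_of_perm hw hperm he hef hl, pow_zero, pow_zero]
    · rw [Pi.add_apply, hu l hl, add_zero]

/-! ## §2 Taylor coefficients of the initial form at `c` = `s^o`-coefficients of the sliced total transform (general weights) -/

/-- COEFFICIENT FORMULA OF THE SLICED CHART for general weights (the `w ≡ 1` case is `CoeffTransport.coeff_cons_slice_subst_chart`):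
the coefficient of `s^b · y^τ` in `(A ∘ chart_{w,c})|_{y_{i₀} = 0}` is `Σ_{w·d = b} A_d ∏_l C(d_l, τ♮_l) c_l^{d_l − τ♮_l}`. -/
theorem coeff_cons_slice_subst_chart_w (w : Fin (n + 1) → ℕ) (c : Fin (n + 1) → k) (hc0 : ∀ l, w l = 0 → c l = 0)
    (i₀ : Fin (n + 1)) (A : MvPowerSeries (Fin (n + 1)) k) (b : ℕ) (τ : Fin n →₀ ℕ) :
    coeff (Finsupp.cons b τ) (TupleGame.slice i₀ (subst (CobordantChart.chart w c) A)) =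
      ∑ᶠ d : Fin (n + 1) →₀ ℕ, if Finsupp.weight w d = b then
        coeff d A * ∏ l, (((d l).choose (Finsupp.mapDomain i₀.succAbove τ l) : k) *
          c l ^ (d l - Finsupp.mapDomain i₀.succAbove τ l)) else 0 := by
  unfold TupleGame.slice
  rw [CobordantChartPlaneSlice.coeff_subst_slice, CoeffTransport.mapDomain_succ_succAbove_cons,
    CobordantChart.coeff_subst_chart w c hc0]

/-- Under permissibility, at an exponent `β` off `x_{i₀}` and off the weight-`0` letters, the Taylor coefficient
`Σ_{|e| = o} f_e ∏_l C(e_l, β_l) c_l^{e_l − β_l}` of the degree-`o` form is the coefficient of `s^o · y^{β off i₀}` in the sliced total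
transform `(f ∘ chart_{w,c})|_{y_{i₀} = 0}` (the two index sets `|e| = o` and `w·e = o` exchange: off them the summands vanish by permissibility
resp. by the chart convention `c_l = 0`). -/
theorem taylorSum_eq_coeff_slice_w (w : Fin (n + 1) → ℕ) (c : Fin (n + 1) → k) (hw : ∀ l, w l ≤ 1)
    (hc0 : ∀ l, w l = 0 → c l = 0) (i₀ : Fin (n + 1)) (f : MvPowerSeries (Fin (n + 1)) k) {o : ℕ}
    (hperm : (o : ℕ∞) ≤ f.weightedOrder w) (β : Fin (n + 1) →₀ ℕ) (hβ : β i₀ = 0) (hβw : ∀ l, w l = 0 → β l = 0) :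
    ∑ e ∈ (Finset.univ : Finset (Fin (n + 1))).finsuppAntidiag o, coeff e f * ∏ l, (((e l).choose (β l) : k) * c l ^ (e l - β l)) =
      coeff (Finsupp.cons o (Finsupp.equivFunOnFinite.symm fun j => β (i₀.succAbove j)))
        (TupleGame.slice i₀ (subst (CobordantChart.chart w c) f)) := by
  classical
  rw [coeff_cons_slice_subst_chart_w w c hc0, mapDomain_succAbove_restrict i₀ β hβ]
  symm
  rw [finsum_eq_sum_of_support_subset _ (s := (Finset.univ : Finset (Fin (n + 1))).finsuppAntidiag o) ?_]
  · refine Finset.sum_congr rfl fun e he => ?_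
    rw [ApexFreeOrderDrop.mem_antidiag_iff, ApexFreeOrderDrop.weight_one_eq_degree] at he
    split_ifs with hwe
    · rfl
    · have hlt : Finsupp.weight w e < o :=
        lt_of_le_of_ne (he ▸ NCTransport.weight_le_degree_of_le_one hw e) hwe
      rw [MvPowerSeries.coeff_eq_zero_of_lt_weightedOrder w (lt_of_lt_of_le (by exact_mod_cast hlt) hperm), zero_mul]
  · intro e he
    rw [Function.mem_support] at he
    rw [Finset.mem_coe, ApexFreeOrderDrop.mem_antidiag_iff, ApexFreeOrderDrop.weight_one_eq_degree]
    by_cases hwe : Finsupp.weight w e = o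
    · rw [if_pos hwe] at he
      have hprod : ∏ l, (((e l).choose (β l) : k) * c l ^ (e l - β l)) ≠ 0 := fun h => he (by rw [h, mul_zero])
      have he0 : ∀ l, w l = 0 → e l = 0 := by
        intro l hl
        by_contra hne
        refine hprod (Finset.prod_eq_zero (Finset.mem_univ l) ?_)
        rw [hc0 l hl, hβw l hl, Nat.sub_zero, zero_pow hne, mul_zero]
      rw [← weight_eq_degree_of_apply_eq_zero hw he0, hwe]
    · exact absurd (if_neg hwe) he

/-- **AT A NEAR POINT OF A PERMISSIBLE BLOW-UP, THE TAYLOR COEFFICIENTS OF THE INITIAL FORM AT `c` OFF `x_{i₀}` VANISH BELOW DEGREE `o`.** -/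
theorem taylorSum_eq_zero_of_near_curve (w : Fin (n + 1) → ℕ) (c : Fin (n + 1) → k) (hw : ∀ l, w l ≤ 1)
    (hc0 : ∀ l, w l = 0 → c l = 0) (i₀ : Fin (n + 1)) (f : MvPowerSeries (Fin (n + 1)) k) {o : ℕ}
    (hperm : (o : ℕ∞) ≤ f.weightedOrder w) {G : MvPowerSeries (Fin (n + 1 + 1)) k}
    (hfac : subst (CobordantChart.chart w c) f = X 0 ^ o * G) (hnear : (o : ℕ∞) ≤ (TupleGame.slice i₀ G).order)
    (β : Fin (n + 1) →₀ ℕ) (hβ : β i₀ = 0) (hβlt : β.degree < o) :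
    ∑ e ∈ (Finset.univ : Finset (Fin (n + 1))).finsuppAntidiag o, coeff e f * ∏ l, (((e l).choose (β l) : k) * c l ^ (e l - β l)) =
      0 := by
  classical
  by_cases hβw : ∀ l, w l = 0 → β l = 0
  · rw [taylorSum_eq_coeff_slice_w w c hw hc0 i₀ f hperm β hβ hβw, hfac, NCTransport.slice_X_zero_pow_mul',
      CoeffTransport.coeff_cons_X_pow_mul]
    refine coeff_of_lt_order (lt_of_lt_of_le ?_ hnear)
    rw [CoeffTransport.degree_cons_zero, degree_restrict i₀ β hβ]
    exact_mod_cast hβlt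
  · push Not at hβw
    obtain ⟨l, hl, hβl⟩ := hβw
    refine Finset.sum_eq_zero fun e he => ?_
    rw [ApexFreeOrderDrop.mem_antidiag_iff, ApexFreeOrderDrop.weight_one_eq_degree] at he
    by_cases hef : coeff e f = 0
    · rw [hef, zero_mul]
    · rw [Finset.prod_eq_zero (Finset.mem_univ l) ?_, mul_zero]
      rw [apply_eq_zero_of_perm hw hperm he hef hl, Nat.choose_eq_zero_of_lt (Nat.pos_of_ne_zero hβl), Nat.cast_zero,
        zero_mul]

/-! ## §3 (N3): near points over `x` lie on `ℙ(Dir / T_x C)` -/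

/-- **(N3) NEAR ⇒ `c ∈ Dir(in_o f)` FOR A PERMISSIBLE COORDINATE CENTRE** (Cossart–Jannsen–Saito Thm 2.6 (2)/(3), Thm 2.14, hypersurface
form, every characteristic, every dimension): weights `w ≤ 1` (centre `C = V(x_l : w_l = 1)`), `f ∈ 𝔭_C^o`, exceptional point `c` over the
origin (`c_l = 0` where `w_l = 0`) with live slot `i₀`, `f ∘ chart_{w,c} = s^o · G`: if the sliced strict transform still has order `≥ o`, then `c`
is a translation-invariance vector of the degree-`o` form of `f` — together with `initEval_add_eq_of_perm` (`T_x C ⊆ Dir`): the near points over `x`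
lie on `ℙ(Dir / T_x C) ⊂ ℙ(N_x)`.  [cite: CossartJannsenSaito2020, Thm 2.6/2.14 (LNM 2270; corpus p0034/p0038)] -/
theorem initEval_add_smul_eq_of_near_curve (w : Fin (n + 1) → ℕ) (c : Fin (n + 1) → k) (hw : ∀ l, w l ≤ 1)
    (hc0 : ∀ l, w l = 0 → c l = 0) (i₀ : Fin (n + 1)) (hc : c i₀ ≠ 0) (f : MvPowerSeries (Fin (n + 1)) k) {o : ℕ}
    (hperm : (o : ℕ∞) ≤ f.weightedOrder w) {G : MvPowerSeries (Fin (n + 1 + 1)) k}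
    (hfac : subst (CobordantChart.chart w c) f = X 0 ^ o * G) (hnear : (o : ℕ∞) ≤ (TupleGame.slice i₀ G).order)
    (t : k) (v : Fin (n + 1) → k) :
    CobordantChart.initEval (fun _ : Fin (n + 1) => 1) (v + t • c) o f = CobordantChart.initEval (fun _ : Fin (n + 1) => 1) v o f :=
  initEval_add_smul_eq_of_slicePlane i₀ hc
    (initEval_add_eq_of_taylor f c i₀ (taylorSum_eq_zero_of_near_curve w c hw hc0 i₀ f hperm hfac hnear)) t v

/-- **(N3), `e_x ≤ 1`: A BLOW-UP IN A PERMISSIBLE CENTRE OF POSITIVE DIMENSION HAS NO NEAR POINT OVER `x`.**  If every two invariance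
vectors of the degree-`o` form of `f` are dependent (`dim Dir ≤ 1`) and the centre has a tangent letter `l` (`w_l = 0`), then at every
exceptional point `c` over `x` and every live slot the sliced strict transform has order `< o` (`c` and `e_l` would be independent
invariance vectors). -/
theorem order_slice_lt_of_apexLine_curve (w : Fin (n + 1) → ℕ) (c : Fin (n + 1) → k) (hw : ∀ l, w l ≤ 1)
    (hc0 : ∀ l, w l = 0 → c l = 0) (i₀ : Fin (n + 1)) (hc : c i₀ ≠ 0) (f : MvPowerSeries (Fin (n + 1)) k) {o : ℕ}
    (hperm : (o : ℕ∞) ≤ f.weightedOrder w)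
    (hone : ∀ u₁ u₂ : Fin (n + 1) → k,
      (∀ v, CobordantChart.initEval (fun _ : Fin (n + 1) => 1) (v + u₁) o f = CobordantChart.initEval (fun _ : Fin (n + 1) => 1) v o f) →
      (∀ v, CobordantChart.initEval (fun _ : Fin (n + 1) => 1) (v + u₂) o f = CobordantChart.initEval (fun _ : Fin (n + 1) => 1) v o f) →
      ∃ α β : k, (α ≠ 0 ∨ β ≠ 0) ∧ α • u₁ + β • u₂ = 0)
    {l : Fin (n + 1)} (hl : w l = 0) {G : MvPowerSeries (Fin (n + 1 + 1)) k}
    (hfac : subst (CobordantChart.chart w c) f = X 0 ^ o * G) :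
    (TupleGame.slice i₀ G).order < o := by
  by_contra hle
  rw [not_lt] at hle
  have hli₀ : l ≠ i₀ := by
    rintro rfl
    exact hc (hc0 _ hl)
  obtain ⟨α, β, hαβ, hrel⟩ := hone c (Pi.single l 1)
    (fun v => by
      have h := initEval_add_smul_eq_of_near_curve w c hw hc0 i₀ hc f hperm hfac hle 1 v
      rwa [one_smul] at h)
    (initEval_add_eq_of_perm hw hperm fun l' hl' => by
      rw [Pi.single_apply, if_neg]
      rintro rfl
      exact hl' hl)
  have h1 := congr_fun hrel i₀
  have h2 := congr_fun hrel l
  simp only [Pi.add_apply, Pi.smul_apply, smul_eq_mul, Pi.single_eq_of_ne hli₀.symm, mul_zero, add_zero,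
    Pi.zero_apply, mul_eq_zero] at h1
  have hα : α = 0 := h1.resolve_right hc
  simp only [Pi.add_apply, Pi.smul_apply, smul_eq_mul, hc0 l hl, mul_zero, zero_add, Pi.single_eq_same, mul_one,
    Pi.zero_apply] at h2
  exact hαβ.elim (fun h => h hα) (fun h => h h2)

/-- **(N3), `e_x ≤ 2`: AT MOST ONE NEAR POINT OVER `x`** (up to the homogeneous scaling of `ℙ(N_x)`): if every three invariance vectors of
the degree-`o` form of `f` are dependent (`dim Dir ≤ 2` — automatic in three letters for a non-zero form of positive degree) and the centre
has a tangent letter `l` (`w_l = 0`), then any two near exceptional points `c`, `c′` over `x` (each with its own live slot and factorisation)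
are proportional. -/
theorem near_dependent_of_apexPlane_curve (w : Fin (n + 1) → ℕ) (hw : ∀ l, w l ≤ 1) (f : MvPowerSeries (Fin (n + 1)) k) {o : ℕ}
    (hperm : (o : ℕ∞) ≤ f.weightedOrder w)
    (htwo : ∀ u₁ u₂ u₃ : Fin (n + 1) → k,
      (∀ v, CobordantChart.initEval (fun _ : Fin (n + 1) => 1) (v + u₁) o f = CobordantChart.initEval (fun _ : Fin (n + 1) => 1) v o f) →
      (∀ v, CobordantChart.initEval (fun _ : Fin (n + 1) => 1) (v + u₂) o f = CobordantChart.initEval (fun _ : Fin (n + 1) => 1) v o f) →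
      (∀ v, CobordantChart.initEval (fun _ : Fin (n + 1) => 1) (v + u₃) o f = CobordantChart.initEval (fun _ : Fin (n + 1) => 1) v o f) →
      ∃ α β γ : k, (α ≠ 0 ∨ β ≠ 0 ∨ γ ≠ 0) ∧ α • u₁ + β • u₂ + γ • u₃ = 0)
    {l : Fin (n + 1)} (hl : w l = 0)
    (c : Fin (n + 1) → k) (hc0 : ∀ l, w l = 0 → c l = 0) (i₀ : Fin (n + 1)) (hc : c i₀ ≠ 0)
    {G : MvPowerSeries (Fin (n + 1 + 1)) k} (hfac : subst (CobordantChart.chart w c) f = X 0 ^ o * G)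
    (hnear : (o : ℕ∞) ≤ (TupleGame.slice i₀ G).order)
    (c' : Fin (n + 1) → k) (hc0' : ∀ l, w l = 0 → c' l = 0) (i₀' : Fin (n + 1)) (hc' : c' i₀' ≠ 0)
    {G' : MvPowerSeries (Fin (n + 1 + 1)) k} (hfac' : subst (CobordantChart.chart w c') f = X 0 ^ o * G')
    (hnear' : (o : ℕ∞) ≤ (TupleGame.slice i₀' G').order) :
    ∃ α β : k, (α ≠ 0 ∨ β ≠ 0) ∧ α • c + β • c' = 0 := by
  obtain ⟨α, β, γ, hne, hrel⟩ := htwo c c' (Pi.single l 1)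
    (fun v => by
      have h := initEval_add_smul_eq_of_near_curve w c hw hc0 i₀ hc f hperm hfac hnear 1 v
      rwa [one_smul] at h)
    (fun v => by
      have h := initEval_add_smul_eq_of_near_curve w c' hw hc0' i₀' hc' f hperm hfac' hnear' 1 v
      rwa [one_smul] at h)
    (initEval_add_eq_of_perm hw hperm fun l' hl' => by
      rw [Pi.single_apply, if_neg]
      rintro rfl
      exact hl' hl)
  have h := congr_fun hrel l
  simp only [Pi.add_apply, Pi.smul_apply, smul_eq_mul, hc0 l hl, hc0' l hl, mul_zero, zero_add, Pi.single_eq_same, mul_one,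
    Pi.zero_apply] at h
  refine ⟨α, β, ?_, ?_⟩
  · rcases hne with h1 | h1 | h1
    · exact Or.inl h1
    · exact Or.inr h1
    · exact absurd h h1
  · rw [h, zero_smul, add_zero] at hrel
    exact hrel

end TOT2Near

end Summit.ResolutionOfSingularities.ResolutionOfSingularities.Theorems
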